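import Summits.AtomisticToContinuum.HydrodynamicLimit.Theorems.TwoClocksClampedEntropyClockDiscreteEntropyGronwall
import HarnessLib

/-!
# The window Gronwall in the log-shell (crux `LambertianEuler`, stmt-AtomisticToContinuum-11854, line `Sketch`, sub-goal `discreteEntropyGronwall_log`)

Helper file (`--supports stmt-AtomisticToContinuum-11854`) proving the registered stub
`discreteEntropyGronwall_log` of the lead's skeleton for the crux
`Summit.AtomisticToContinuum.HydrodynamicLimit.Theses.LambertianContactSwap.LambertianEuler`
(line `Sketch`). It is the purely real-analytic last step of Yau's relative-entropy clock:
nonnegative quantities `H N s` on `[0, t]` with `H N 0 / (N+1) → 0`, a full-window step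
`H N (s + w) ≤ (1 + A w) H N s + w (N+1) ε` and a last-partial-window step `H N t ≤ H N s + (N+1) ε`
give `H N t / (N+1) → 0`.

Difference from the landed fixed-rate lemma `QuenchedCellClock.stub_discreteEntropyGronwall`
(rate `A` fixed before `ε`): here the Gronwall rate `A` is chosen AFTER the per-window error `ε`,
but inside the log-shell `A ≤ κ |log ε|` for any prescribed `κ > 0` once `ε < ε₀(κ)`.

Proof summary. Fix `δ > 0`. Take `κ := 1 / (2t)`, get `ε₀`; pick `η > 0` with `η ≤ 1/2`,
`η ≤ ε₀ / 2`, `(t + 1) η < δ`, and put `ε := η²` (so `0 < ε ≤ η < ε₀`, `log ε = 2 log η < 0`).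
The hypothesis yields `A ≤ κ |log ε| = -log η / t`, whence `exp (A t) ≤ exp (-log η) = η⁻¹`.
For `N ≥ N₀` the one-`N` bound `QuenchedCellClock.window_gronwall_bound` gives
`H N t / (N+1) ≤ exp (A t) · (H N 0 / (N+1)) + (exp (A t) · t ε + ε)` with
`exp (A t) · t ε + ε ≤ t η + η² ≤ (t + 1) η < δ`; since `exp (A t) · (H N 0 / (N+1)) → 0`, eventually
`0 ≤ H N t / (N+1) < δ`.
-/

noncomputable section

namespace Summit.AtomisticToContinuum.HydrodynamicLimit.Theorems.LambertianContactSwapLambertianEulerDiscreteEntropyGronwallLog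

open Filter Topology

/-- **Window Gronwall in the log-shell.** Nonnegative quantities `H N s` with `H N 0 / (N+1) → 0`;
for every `κ > 0` there is `ε₀ > 0` such that every error level `0 < ε < ε₀` admits a rate
`0 ≤ A ≤ κ |log ε|`, window lengths `w N > 0` and `N₀` such that for `N ≥ N₀` one full window costs
`H N (s + w N) ≤ (1 + A·w N) H N s + w N (N+1) ε` (windows inside `[0, t]`) and the last partial window
costs `H N t ≤ H N s + (N+1) ε` (`t - w N ≤ s ≤ t`). Then `H N t / (N+1) → 0`: with `κ = 1/(2t)` and
`ε = η²` one has `exp (A t) ≤ η⁻¹`, so the telescoped bound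
`H N t / (N+1) ≤ exp (A t) (H N 0 / (N+1)) + exp (A t) t ε + ε ≤ exp (A t) (H N 0 / (N+1)) + (t+1) η`
is eventually below any `δ > 0`. [folklore] -/
theorem discreteEntropyGronwall_log : ∀ (H : ℕ → ℝ → ℝ) {t : ℝ}, 0 < t → (∀ N s, 0 ≤ H N s) → Filter.Tendsto (fun N : ℕ => H N 0 / ((N : ℝ) + 1)) Filter.atTop (nhds 0) → (∀ κ : ℝ, 0 < κ → ∃ ε₀ : ℝ, 0 < ε₀ ∧ ∀ ε : ℝ, 0 < ε → ε < ε₀ → ∃ A : ℝ, 0 ≤ A ∧ A ≤ κ * |Real.log ε| ∧ ∃ w : ℕ → ℝ, (∀ N, 0 < w N) ∧ ∃ N₀ : ℕ, ∀ N : ℕ, N₀ ≤ N → (∀ s : ℝ, 0 ≤ s → s + w N ≤ t → H N (s + w N) ≤ (1 + A * w N) * H N s + w N * ((N : ℝ) + 1) * ε) ∧ (∀ s : ℝ, 0 ≤ s → s ≤ t → t ≤ s + w N → H N t ≤ H N s + ((N : ℝ) + 1) * ε)) → Filter.Tendsto (fun N : ℕ => H N t / ((N : ℝ) + 1)) Filter.atTop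 (nhds 0) := by
  intro H t ht hH0 hzero hstep
  rw [Metric.tendsto_atTop]
  intro δ hδ
  -- the log-shell at `κ := 1 / (2 t)`
  obtain ⟨ε₀, hε₀, hshell⟩ := hstep (1 / (2 * t)) (by positivity)
  -- a small parameter `η`, and the error level `ε := η ^ 2`
  obtain ⟨η, hη, hη1, hηε₀, hηδ⟩ :
      ∃ η : ℝ, 0 < η ∧ η ≤ 1 / 2 ∧ η ≤ ε₀ / 2 ∧ (t + 1) * η < δ := by
    obtain ⟨η', hη', hη'δ⟩ := exists_pos_mul_lt hδ (t + 1)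
    refine ⟨min η' (min (1 / 2) (ε₀ / 2)), lt_min hη' (lt_min (by norm_num) (by positivity)),
      (min_le_right _ _).trans (min_le_left _ _), (min_le_right _ _).trans (min_le_right _ _), ?_⟩
    have : (t + 1) * min η' (min (1 / 2) (ε₀ / 2)) ≤ (t + 1) * η' :=
      mul_le_mul_of_nonneg_left (min_le_left _ _) (by positivity)
    exact this.trans_lt hη'δ
  have hηsq : η ^ 2 ≤ η := by nlinarith
  have hε : (0 : ℝ) < η ^ 2 := by positivity
  have hεε₀ : η ^ 2 < ε₀ := by linarith
  obtain ⟨A, hA, hAle, w, hw, N₀, hN₀⟩ := hshell (η ^ 2) hε hεε₀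
  -- `exp (A t) ≤ η⁻¹`
  have hlogη : Real.log η < 0 := Real.log_neg hη (by linarith)
  have hlogε : Real.log (η ^ 2) = 2 * Real.log η := by
    rw [Real.log_pow]
    push_cast
    ring
  have hAt : A * t ≤ -Real.log η := by
    have h1 : A * t ≤ 1 / (2 * t) * |Real.log (η ^ 2)| * t :=
      mul_le_mul_of_nonneg_right hAle ht.le
    have h2 : 1 / (2 * t) * |Real.log (η ^ 2)| * t = -Real.log η := by
      rw [hlogε, abs_of_neg (by linarith)]
      field_simp
    linarith
  have hexp : Real.exp (A * t) ≤ η⁻¹ := by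
    calc Real.exp (A * t) ≤ Real.exp (-Real.log η) := Real.exp_le_exp.2 hAt
      _ = η⁻¹ := by rw [Real.exp_neg, Real.exp_log hη]
  -- the slack
  have hslack : Real.exp (A * t) * (t * η ^ 2) + η ^ 2 < δ := by
    have h1 : Real.exp (A * t) * (t * η ^ 2) ≤ η⁻¹ * (t * η ^ 2) :=
      mul_le_mul_of_nonneg_right hexp (by positivity)
    have h2 : η⁻¹ * (t * η ^ 2) = t * η := by
      field_simp
    nlinarith
  -- the one-`N` bound, for `N ≥ N₀`
  have key : ∀ᶠ N : ℕ in atTop,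
      H N t / ((N : ℝ) + 1) ≤ Real.exp (A * t) * (H N 0 / ((N : ℝ) + 1)) +
        (Real.exp (A * t) * (t * η ^ 2) + η ^ 2) := by
    refine Filter.eventually_atTop.2 ⟨N₀, fun N hN => ?_⟩
    obtain ⟨hfull, hpart⟩ := hN₀ N hN
    have hM : (0 : ℝ) < (N : ℝ) + 1 := by positivity
    have hb := QuenchedCellClock.window_gronwall_bound (H N) ht hA (hw N) hM hε.le (hH0 N)
      hfull hpart
    rw [div_le_iff₀ hM]
    have hx : Real.exp (A * t) * (H N 0 / ((N : ℝ) + 1) * ((N : ℝ) + 1)) =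
        Real.exp (A * t) * H N 0 := by
      rw [div_mul_cancel₀ _ hM.ne']
    linarith [hb, hx]
  -- the slack is positive, and `exp (A t) · (H N 0 / (N+1))` is eventually below it
  have hgap : 0 < δ - (Real.exp (A * t) * (t * η ^ 2) + η ^ 2) := by linarith
  have hlim : Tendsto (fun N : ℕ => Real.exp (A * t) * (H N 0 / ((N : ℝ) + 1))) atTop (𝓝 0) := by
    have h := hzero.const_mul (Real.exp (A * t))
    rwa [mul_zero] at h
  have h2 : ∀ᶠ N : ℕ in atTop,
      Real.exp (A * t) * (H N 0 / ((N : ℝ) + 1)) <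
        δ - (Real.exp (A * t) * (t * η ^ 2) + η ^ 2) :=
    hlim.eventually (gt_mem_nhds hgap)
  obtain ⟨N₁, hN₁⟩ := Filter.eventually_atTop.1 (key.and h2)
  refine ⟨N₁, fun N hN => ?_⟩
  obtain ⟨ha, hb⟩ := hN₁ N hN
  rw [Real.dist_eq, sub_zero, abs_of_nonneg (div_nonneg (hH0 N t) (by positivity))]
  linarith

end Summit.AtomisticToContinuum.HydrodynamicLimit.Theorems.LambertianContactSwapLambertianEulerDiscreteEntropyGronwallLog

end
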